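import Literature.Analysis.FluidPDE.ElgindiTensorHk
import Literature.Analysis.FluidPDE.ElgindiHardyL12
import Literature.Analysis.FluidPDE.ElgindiMomentCalculus
import HarnessLib

/-!
# The radial energies of the `K`-moment are controlled by the `𝓗⁴` functional
([Elgindi2021] §7.5: the corrector of Theorem 2 is built from `F⋆ = (F, cos²θ sin θ)_θ`)

Topic `Literature/Analysis/FluidPDE`. Proof file (everything proved, no definitions, no named
facts) on the proof path of the named fact
`Literature.Analysis.FluidPDE.Elgindi.ElgindiGhoulMasmoudi2021_stabilityCore`
(`ElgindiStabilityDecomposition.lean`). T. M. Elgindi, Ann. of Math. 194 (2021) =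
arXiv:1904.04795, §7.5 (p. 24).

For a smooth compactly supported `F`:
`A_j(kMoment F) = ∫_{R>0} w²(Dz₁^j(K,F)_θ)² ≤ (9π/32)·‖D_R^jF·w/sin^{η/2}‖²_{L²(strip)} ≤ (9π/32)|F|²_{𝓗⁴}`
(`radialEnergy_kMoment_le`): `Dz₁^j` passes onto `F` (`iterate_Dz₁_kMoment`), Cauchy–Schwarz in `θ`
(`sq_kMoment_le`), Tonelli, and `sin^{−η} ≥ 1`.
-/

noncomputable section

open MeasureTheory Set Real Filter Function Finset
open _root_.Topology
open scoped ENNReal ContDiff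

namespace Literature.Analysis.FluidPDE

namespace Elgindi

/-- `1 ≤ sin(2θ)^{−η}` on the strip. [folklore] -/
theorem one_le_sin_rpow_neg_eta {p : ℝ × ℝ} (hp : p ∈ strip) : 1 ≤ Real.sin (2 * p.2) ^ (-eta) := by
  have hs : 0 < Real.sin (2 * p.2) := Real.sin_pos_of_pos_of_lt_pi (by linarith [hp.2.1]) (by linarith [hp.2.2])
  have hs1 : Real.sin (2 * p.2) ≤ 1 := Real.sin_le_one _
  exact Real.one_le_rpow_of_pos_of_le_one_of_nonpos hs hs1 (by unfold eta; norm_num)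

/-- **`A_j(kMoment F) ≤ (9π/32)·eL2Sq(hkRadialTerm j F)`** for `F ∈ C^j` compactly supported. [cite: Elgindi2021, §7.5 (p. 24 of arXiv:1904.04795)] -/
theorem radialEnergy_kMoment_le {F : ℝ → ℝ → ℝ} {j : ℕ} (hF : ContDiff ℝ j (uncurry F)) (hs : HasCompactSupport (uncurry F)) :
    radialEnergy j (kMoment F) ≤ ENNReal.ofReal (9 * π / 32) * eL2Sq (hkRadialTerm j F) := by
  have hG0 : ContDiff ℝ 0 (uncurry (Dz^[j] F)) := contDiff_iterate_Dz_of_contDiff (n := 0) (m := j) (by simpa using hF)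
  have hGc : Continuous (uncurry (Dz^[j] F)) := hG0.continuous
  have hGs : HasCompactSupport (uncurry (Dz^[j] F)) := hasCompactSupport_iterate_Dz hs j
  set G : ℝ → ℝ → ℝ := Dz^[j] F with hGdef
  -- `Dz₁^j (kMoment F) = kMoment G`
  have e1 : ∀ R, (Dz₁^[j] (kMoment F)) R = kMoment G R := fun R => iterate_Dz₁_kMoment hF hs R
  unfold radialEnergy
  simp_rw [e1]
  -- Cauchy–Schwarz slice-wise
  have hslice : ∀ R, radialWeight R ^ 2 * kMoment G R ^ 2 ≤ 9 * π / 32 * ∫ θ in Ioo 0 (π / 2), radialWeight R ^ 2 * G R θ ^ 2 := by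
    intro R
    have h := sq_kMoment_le hGc R
    rw [← MeasureTheory.integral_const_mul]
    have e : ∫ θ in Ioo 0 (π / 2), radialWeight R ^ 2 * G R θ ^ 2 = radialWeight R ^ 2 * ∫ θ in Ioo 0 (π / 2), G R θ ^ 2 := by
      rw [← MeasureTheory.integral_const_mul]
    rw [MeasureTheory.integral_const_mul, e]
    nlinarith [sq_nonneg (radialWeight R), mul_le_mul_of_nonneg_left h (sq_nonneg (radialWeight R))]
  -- Tonelli: `∫⁻_R ofReal(∫_θ H) = ∫⁻_strip ofReal H`
  have hH : Continuous fun p : ℝ × ℝ => G p.1 p.2 ^ 2 := (hGc.pow 2)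
  have hint : ∀ R, IntegrableOn (fun θ => radialWeight R ^ 2 * G R θ ^ 2) (Ioo 0 (π / 2)) := fun R =>
    ((continuous_const.mul (hH.comp (Continuous.prodMk_right R))).integrableOn_Icc).mono_set Ioo_subset_Icc_self
  calc ∫⁻ R in Ioi 0, ENNReal.ofReal (radialWeight R ^ 2 * kMoment G R ^ 2)
      ≤ ∫⁻ R in Ioi 0, ENNReal.ofReal (9 * π / 32 * ∫ θ in Ioo 0 (π / 2), radialWeight R ^ 2 * G R θ ^ 2) :=
        lintegral_mono fun R => ENNReal.ofReal_le_ofReal (hslice R)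
    _ = ENNReal.ofReal (9 * π / 32) * ∫⁻ R in Ioi 0, ∫⁻ θ in Ioo 0 (π / 2), ENNReal.ofReal (radialWeight R ^ 2 * G R θ ^ 2) := by
        rw [← lintegral_const_mul' _ _ ENNReal.ofReal_ne_top]
        refine lintegral_congr fun R => ?_
        rw [ENNReal.ofReal_mul (by positivity), ofReal_integral_eq_lintegral_ofReal (hint R) (ae_of_all _ fun θ => by positivity)]
    _ = ENNReal.ofReal (9 * π / 32) * ∫⁻ p in strip, ENNReal.ofReal (radialWeight p.1 ^ 2 * G p.1 p.2 ^ 2) := by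
        congr 1
        have hprod : (volume.restrict strip : Measure (ℝ × ℝ)) = (volume.restrict (Ioi (0:ℝ))).prod (volume.restrict (Ioo 0 (π / 2))) := by
          rw [show strip = Ioi (0:ℝ) ×ˢ Ioo 0 (π / 2) from rfl, Measure.volume_eq_prod, Measure.prod_restrict]
        have hm : Measurable fun p : ℝ × ℝ => ENNReal.ofReal (radialWeight p.1 ^ 2 * G p.1 p.2 ^ 2) := by
          refine Measurable.ennreal_ofReal ?_
          have : Measurable fun p : ℝ × ℝ => radialWeight p.1 ^ 2 := by unfold radialWeight; fun_prop
          exact this.mul (hH.measurable)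
        rw [hprod, lintegral_prod _ hm.aemeasurable]
    _ ≤ ENNReal.ofReal (9 * π / 32) * eL2Sq (hkRadialTerm j F) := by
        refine mul_le_mul_right ?_ _
        rw [eL2Sq_eq_lintegral_ofReal]
        refine setLIntegral_mono' measurableSet_strip fun p hp => ENNReal.ofReal_le_ofReal ?_
        rw [sq_hkRadialTerm j F hp]
        have h1 := one_le_sin_rpow_neg_eta hp
        have hw : 0 ≤ radialWeight p.1 ^ 2 * G p.1 p.2 ^ 2 := by positivity
        calc radialWeight p.1 ^ 2 * G p.1 p.2 ^ 2 = radialWeight p.1 ^ 2 * G p.1 p.2 ^ 2 * 1 := by ring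
          _ ≤ radialWeight p.1 ^ 2 * (Dz^[j] F) p.1 p.2 ^ 2 * Real.sin (2 * p.2) ^ (-eta) := mul_le_mul_of_nonneg_left h1 hw

/-- **Corollary: `Σ_{j≤4} A_j(kMoment F) ≤ (9π/32)·5·|F|²_{𝓗⁴}`.** [folklore] -/
theorem sum_radialEnergy_kMoment_le {F : ℝ → ℝ → ℝ} (hF : ContDiff ℝ 4 (uncurry F)) (hs : HasCompactSupport (uncurry F)) (α : ℝ) :
    ∑ j ∈ range 5, radialEnergy j (kMoment F) ≤ ENNReal.ofReal (9 * π / 32) * (5 * eHkNormSq α 4 F) := by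
  calc ∑ j ∈ range 5, radialEnergy j (kMoment F)
      ≤ ∑ j ∈ range 5, ENNReal.ofReal (9 * π / 32) * eHkNormSq α 4 F := by
        refine sum_le_sum fun j hj => ?_
        have hj' : j ≤ 4 := Nat.lt_succ_iff.1 (mem_range.1 hj)
        exact (radialEnergy_kMoment_le (hF.of_le (by exact_mod_cast hj')) hs).trans (mul_le_mul_right (eL2Sq_hkRadialTerm_le α hj' F) _)
    _ = ENNReal.ofReal (9 * π / 32) * (5 * eHkNormSq α 4 F) := by
        rw [sum_const, card_range, nsmul_eq_mul]; push_cast; ring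

end Elgindi

end Literature.Analysis.FluidPDE
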